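import Literature.Analysis.FluidPDE.SeisDissipationRateBoundProofs
import Literature.Analysis.FluidPDE.PassiveScalarReleaseExistence
import Summits.AnomalousDissipation.AnomalousDissipation.Theses.LimitingAbsorption
import Summits.AnomalousDissipation.AnomalousDissipation.Theorems.LimitingAbsorptionRelaxationBoundsInventoryShift
import Summits.AnomalousDissipation.AnomalousDissipation.Theorems.RelaxingFamily.Negative.GlobalWeakScalar
import HarnessLib

/-!
# Negative knowledge for the crux `RelaxingFamily` (stmt-AnomalousDissipation-15009), I: a witness
# cannot have a linear windowed enstrophy budget — the Seis floor

Refuted strengthening (`_false_without_` shape) of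
`Summit.AnomalousDissipation.AnomalousDissipation.Theses.LimitingAbsorption.RelaxingFamily` (route
`route-AnomalousDissipation-LimitingAbsorption`, crux r3; supports stmt-AnomalousDissipation-15009):

* `RelaxingFamilyUnder Hyp` — the crux VERBATIM with one extra hypothesis `Hyp g h ν v` on the witness
  (`relaxingFamilyUnder_true_iff`: with `Hyp := ⊤` it is the crux; `RelaxingFamilyUnder.mono`,
  `RelaxingFamilyUnder.relaxingFamily`); typed by crux-ideate ideator 1
  (`Cruxes/RelaxingFamily/SketchIdeator1.lean`), re-declared here because crux workfiles are not importable.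
* `LinearEnstrophyBudget g h ν v` — for one slope `M` and every level `j` there is a phase `s_j ≥ 0` after
  which the drift `v_j(s_j + ·)` has essentially bounded energy and the LINEAR windowed budget
  `∫₀ᵗ ‖∇v_j(s_j + τ)‖_{L²} dτ ≤ M (1 + t)` for all `t > 0` (Seis 2022, Remark 1).
* `relaxingFamily_false_without_superlinearEnstrophy : ¬ RelaxingFamilyUnder LinearEnstrophyBudget` —
  UNCONDITIONAL (the tree proves `Seis2022_rmk1_L2_holds`): any witness of the crux must, from EVERY phase,
  exceed every `j`-uniform linear budget of windowed enstrophy^{1/2}; in particular no family with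
  `j`-uniformly bounded enstrophy from some phase on (single-shell forcing by the ShellPincer bound,
  uniformly band-limited stirring, states converging in `H¹`, laminar / condensate regimes) is a witness.

Proof: take the level `j` with `ν_j ≤ κ₀` and `log(1/ν_j) > 2K/γ + 1`, where `(κ₀, K)` are Seis' constants
for the profile data `(‖h‖₁, ‖∇h‖₁, C₀ = √((C+1)‖h‖₂²), M)`; glue the per-horizon releases of `h` into the
drift `v_j(s_j + ·)` (`Torus.IsGlobalLerayHopf.exists_release`, bounded-drift uniqueness,
`exists_global_isWeakScalarTransportOn`) to one weak scalar `θ` on every `[0,T)`; the crux's clause gives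
`‖θ(t)‖² ≤ C e^{-γt}‖h‖² ≤ (C₀ e^{-γt/2})²` for a.e. `t > 0`; Seis' Remark 1 gives `γ/2 ≤ K/log(1/ν_j)`,
contradiction.

## References

* C. Seis, Comm. Math. Phys. 399 (2023) 2071–2081 = arXiv:2003.08794, Thm. 2, Rmk. 1. [`Seis2022`]
* R. J. DiPerna, P.-L. Lions, Invent. Math. 98 (1989), Prop. II.1 (existence of weak scalars).
  [`DiPernaLions1989`]
-/

noncomputable section

open MeasureTheory Set Filter Function TopologicalSpace Topology
open scoped ENNReal NNReal InnerProductSpace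

namespace Summit.AnomalousDissipation.AnomalousDissipation.Theorems.RelaxingFamily.Negative

-- D-0017: single-problem summit ⇒ `Summit.AnomalousDissipation.AnomalousDissipation.…` by design.
set_option linter.dupNamespace false

open Literature.Analysis.FunctionSpaces Literature.Analysis.FunctionSpaces.Torus
open Literature.Analysis.FluidPDE Literature.Analysis.FluidPDE.Torus
open Summit.AnomalousDissipation.AnomalousDissipation.Theses.LimitingAbsorption

/-- The unit flat 2-torus (local notation). -/
local notation "𝕋²" => UnitAddTorus (Fin 2)
/-- Planar vectors (local notation). -/
local notation "E²" => EuclideanSpace ℝ (Fin 2)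

/-! ## The crux with an extra hypothesis on the witness -/

/-- Phase-uniform, `ν`-uniform exponential relaxation of the profile `h` along the family `(ν, v)` with
constants `(C, γ)` — the (U_h) clause of the crux `RelaxingFamily`, verbatim. -/
def RelaxesUniformly (ν : ℕ → ℝ) (v : ℕ → ℝ → 𝕋² → E²) (h : 𝕋² → ℝ) (C γ : ℝ) : Prop :=
  ∀ (j : ℕ) (s : ℝ), 0 ≤ s → ∀ (T : ℝ) (θ : ℝ → 𝕋² → ℝ),
    IsWeakScalarTransportOn T (ν j) (fun t => v j (s + t)) h θ →
      ∀ᵐ t ∂(volume.restrict (Ioo (0 : ℝ) T)),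
        scalarL2Sq (θ t) ≤ C * Real.exp (-(γ * t)) * scalarL2Sq h

/-- The crux `RelaxingFamily` with an EXTRA hypothesis `Hyp g h ν v` on the witness: the common shape of
refuted strengthenings (`¬ RelaxingFamilyUnder Hyp` reads "any witness of the crux leaves the class `Hyp`"). -/
def RelaxingFamilyUnder
    (Hyp : (𝕋² → E²) → (𝕋² → ℝ) → (ℕ → ℝ) → (ℕ → ℝ → 𝕋² → E²) → Prop) : Prop :=
  ∃ (g : 𝕋² → E²) (h : 𝕋² → ℝ), IsSmooth g ∧ IsDivFree g ∧ HasZeroMean g ∧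
    IsSmooth h ∧ HasZeroMean h ∧ h ≠ 0 ∧
    ∃ (ν : ℕ → ℝ) (v₀ : ℕ → 𝕋² → E²) (v : ℕ → ℝ → 𝕋² → E²),
      (∀ j, 0 < ν j) ∧ Tendsto ν atTop (𝓝 0) ∧
      (∀ j, IsGlobalLerayHopf (ν j) (fun _ => g) (v₀ j) (v j)) ∧
      (∀ j (T : ℝ), 0 < T →
        MemLp (stLift (v j)) ⊤ (volume.restrict (Ioo (0 : ℝ) T ×ˢ univ))) ∧
      (∃ E : ℝ, ∀ j, meanEnergy (v j) ≤ E) ∧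
      Hyp g h ν v ∧
      ∃ C γ : ℝ, 0 ≤ C ∧ 0 < γ ∧ RelaxesUniformly ν v h C γ

/-- Sanity: with the trivial extra hypothesis `RelaxingFamilyUnder` is the crux itself. [folklore] -/
theorem relaxingFamilyUnder_true_iff :
    RelaxingFamilyUnder (fun _ _ _ _ => True) ↔ RelaxingFamily := by
  unfold RelaxingFamilyUnder RelaxesUniformly RelaxingFamily
  simp only [true_and]

/-- Monotonicity of `RelaxingFamilyUnder` in the extra hypothesis. [folklore] -/
theorem RelaxingFamilyUnder.mono
    {H₁ H₂ : (𝕋² → E²) → (𝕋² → ℝ) → (ℕ → ℝ) → (ℕ → ℝ → 𝕋² → E²) → Prop}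
    (h12 : ∀ g h ν v, H₁ g h ν v → H₂ g h ν v) (h1 : RelaxingFamilyUnder H₁) :
    RelaxingFamilyUnder H₂ := by
  obtain ⟨g, h, hg, hgd, hgm, hh, hhm, hh0, ν, v₀, v, hν, hνlim, hLH, hbd, hE, hH, hrest⟩ := h1
  exact ⟨g, h, hg, hgd, hgm, hh, hhm, hh0, ν, v₀, v, hν, hνlim, hLH, hbd, hE, h12 _ _ _ _ hH, hrest⟩

/-- A witness of the crux under any extra hypothesis is a witness of the crux. [folklore] -/
theorem RelaxingFamilyUnder.relaxingFamily
    {H : (𝕋² → E²) → (𝕋² → ℝ) → (ℕ → ℝ) → (ℕ → ℝ → 𝕋² → E²) → Prop}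
    (h1 : RelaxingFamilyUnder H) : RelaxingFamily :=
  relaxingFamilyUnder_true_iff.1 (h1.mono fun _ _ _ _ _ => trivial)

/-! ## The excluded class: a linear windowed enstrophy budget from some phase on -/

/-- **Linear windowed enstrophy budget** (the velocity class of Seis 2022, Remark 1, met from some
phase on at every level with ONE slope): there is `M ≥ 0` such that for every `j` some phase `s_j ≥ 0`
has (i) essentially bounded energy of the drift `v_j(s_j + ·)` on `t > 0` (automatic for planar
Leray–Hopf solutions with bounded force; recorded because the weak class does not carry it) and (ii)
`∫₀ᵗ ‖∇v_j(s_j + τ)‖_{L²} dτ ≤ M (1 + t)` for all `t > 0`, with `‖∇w‖_{L²} = (eGradNormSq w)^{1/2}`. -/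
def LinearEnstrophyBudget (_g : 𝕋² → E²) (_h : 𝕋² → ℝ) (_ν : ℕ → ℝ)
    (v : ℕ → ℝ → 𝕋² → E²) : Prop :=
  ∃ M : ℝ, 0 ≤ M ∧ ∀ j : ℕ, ∃ s : ℝ, 0 ≤ s ∧
    (∃ M' : ℝ≥0, ∀ᵐ t ∂(volume.restrict (Ioi (0 : ℝ))), ∫⁻ x, ‖v j (s + t) x‖ₑ ^ 2 ≤ M') ∧
    ∀ t : ℝ, 0 < t →
      ∫⁻ τ in Ioo 0 t, eGradNormSq (v j (s + τ)) ^ (1 / 2 : ℝ) ≤ ENNReal.ofReal (M * (1 + t))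

/-! ## Profile constants -/

/-- A smooth profile `h ≠ 0` has `‖h‖_{L¹} > 0`. [folklore] -/
theorem integral_abs_pos_of_ne_zero {h : 𝕋² → ℝ} (hh : IsSmooth h) (hh0 : h ≠ 0) :
    0 < ∫ x, |h x| := by
  have hint : Integrable h volume := memLp_one_iff_integrable.1 (hh.memLp 1)
  rw [integral_pos_iff_support_of_nonneg (fun x => abs_nonneg (h x)) hint.abs]
  have hsupp : Function.support (fun x => |h x|) = Function.support h := by
    ext x; simp
  rw [hsupp]
  obtain ⟨x, hx⟩ : ∃ x, h x ≠ 0 := Function.ne_iff.1 hh0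
  exact (isOpen_ne_fun hh.continuous continuous_const).measure_pos volume ⟨x, hx⟩

/-- A smooth profile `h ≠ 0` has `‖h‖²_{L²} > 0`. [folklore] -/
theorem scalarL2Sq_pos_of_ne_zero {h : 𝕋² → ℝ} (hh : IsSmooth h) (hh0 : h ≠ 0) :
    0 < scalarL2Sq h := by
  unfold scalarL2Sq
  rw [integral_pos_iff_support_of_nonneg (fun x => sq_nonneg (h x)) (hh.memLp 2).integrable_sq]
  have hsupp : Function.support (fun x => h x ^ 2) = Function.support h := by
    ext x; simp
  rw [hsupp]
  obtain ⟨x, hx⟩ : ∃ x, h x ≠ 0 := Function.ne_iff.1 hh0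
  exact (isOpen_ne_fun hh.continuous continuous_const).measure_pos volume ⟨x, hx⟩

/-! ## The theorem -/

/-- **`RelaxingFamily` is false without super-linear enstrophy growth** (Seis' floor, unconditional):
no witness of the crux admits a `j`-uniform linear windowed budget of `‖∇v_j‖_{L²}` from some phase on.
Any proof of `RelaxingFamily` must therefore produce planar Leray–Hopf families whose windowed mean
enstrophy^{1/2} exceeds every linear budget from every phase (by the sharp form of Seis' bound, grows like
`log(1/ν_j)`) while the energy stays bounded. [cite: Seis2022, Thm 2 and Remark 1 (arXiv:2003.08794 pp. 3–4)] -/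
theorem relaxingFamily_false_without_superlinearEnstrophy :
    ¬ RelaxingFamilyUnder LinearEnstrophyBudget := by
  rintro ⟨g, h, -, -, -, hh, hhm, hh0, ν, v₀, v, hν, hνlim, hLH, hbd, -, ⟨M, hM, hbudget⟩, C, γ, hC,
    hγ, hrelax⟩
  -- profile constants
  have ha : 0 < ∫ x, |h x| := integral_abs_pos_of_ne_zero hh hh0
  have hS : 0 < scalarL2Sq h := scalarL2Sq_pos_of_ne_zero hh hh0
  set C₀ : ℝ := Real.sqrt ((C + 1) * scalarL2Sq h) with hC₀def
  have hC₀sq : C₀ ^ 2 = (C + 1) * scalarL2Sq h := Real.sq_sqrt (by positivity)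
  have hC₀ : 0 < C₀ := Real.sqrt_pos.2 (by positivity)
  -- Seis' constants for these data
  obtain ⟨κ₀, K, hκ₀, -, hK, hSeis⟩ :=
    Seis2022_rmk1_L2_holds (d := Fin 2) (∫ x, |h x|) (∫ x, |h x|) (∫ x, ‖Torus.gradient h x‖) C₀ M
      ha hC₀ hM
  -- the level `j`: `ν_j ≤ κ₀` and `log (1/ν_j) > 2K/γ + 1`
  set L₀ : ℝ := 2 * K / γ + 1 with hL₀
  have hL₀pos : 0 < L₀ := by
    have : 0 ≤ 2 * K / γ := by positivity
    linarith
  obtain ⟨j, hj⟩ : ∃ j, ν j < min κ₀ (Real.exp (-L₀)) :=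
    (hνlim.eventually (gt_mem_nhds (lt_min hκ₀ (Real.exp_pos _)))).exists
  have hνκ : ν j ≤ κ₀ := (hj.trans_le (min_le_left _ _)).le
  have hlog : L₀ < Real.log (ν j)⁻¹ := by
    rw [Real.log_inv]
    have h1 : Real.log (ν j) < Real.log (Real.exp (-L₀)) :=
      Real.log_lt_log (hν j) (hj.trans_le (min_le_right _ _))
    rw [Real.log_exp] at h1
    linarith
  -- the phase and the budget at level `j`
  obtain ⟨s, hs, hM', hbud⟩ := hbudget j
  -- the drift `v_j (s + ·)` is bounded on every `(0,T) × T²`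
  have hu : ∀ T : ℝ, 0 < T →
      MemLp (stLift fun t => v j (s + t)) ⊤ (volume.restrict (Ioo (0 : ℝ) T ×ˢ univ)) := by
    intro T hT
    have := LapInventory.memLp_top_stLift_comp_const_add hs (hbd j (s + T) (by linarith))
    rwa [show s + T - s = T by ring] at this
  -- releases of `h` into it exist on every horizon; glue them
  have hex : ∀ T : ℝ, 0 < T → ∃ θ : ℝ → 𝕋² → ℝ,
      IsWeakScalarTransportOn T (ν j) (fun t => v j (s + t)) h θ := fun T hT =>
    let ⟨θ, hθ, _⟩ := (hLH j).exists_release (hν j) hT hs (hh.memLp 2)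
    ⟨θ, hθ⟩
  obtain ⟨θ, hθ⟩ := exists_global_isWeakScalarTransportOn (hν j) hu hex
  -- the decay clause along `θ`, for a.e. `t > 0`
  have hdecT : ∀ n : ℕ, ∀ᵐ t ∂(volume.restrict (Ioo (0 : ℝ) ((n : ℝ) + 1))),
      scalarL2Sq (θ t) ≤ C * Real.exp (-(γ * t)) * scalarL2Sq h := fun n =>
    hrelax j s hs _ θ (hθ _ (by positivity))
  have hdec : ∀ᵐ t ∂(volume.restrict (Ioi (0 : ℝ))),
      scalarL2Sq (θ t) ≤ (C₀ * Real.exp (-(γ / 2 * t))) ^ 2 := by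
    have hall : ∀ᵐ t ∂(volume : Measure ℝ), ∀ n : ℕ, t ∈ Ioo (0 : ℝ) ((n : ℝ) + 1) →
        scalarL2Sq (θ t) ≤ C * Real.exp (-(γ * t)) * scalarL2Sq h :=
      ae_all_iff.2 fun n => (ae_restrict_iff' measurableSet_Ioo).1 (hdecT n)
    rw [ae_restrict_iff' measurableSet_Ioi]
    filter_upwards [hall] with t ht ht0
    have hb := ht ⌊t⌋₊ ⟨ht0, Nat.lt_floor_add_one t⟩
    have hexp : (C₀ * Real.exp (-(γ / 2 * t))) ^ 2 = (C + 1) * scalarL2Sq h * Real.exp (-(γ * t)) := by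
      rw [mul_pow, hC₀sq, ← Real.exp_nat_mul]
      congr 1; push_cast; ring_nf
    rw [hexp]
    have hE : 0 ≤ Real.exp (-(γ * t)) := (Real.exp_pos _).le
    nlinarith [hS.le]
  -- Seis' Remark 1 at rate `γ/2`
  have hD : γ / 2 ≤ K / Real.log (ν j)⁻¹ :=
    hSeis (ν j) (γ / 2) (fun t => v j (s + t)) h θ (hν j) hνκ hM' hbud hh hhm le_rfl le_rfl le_rfl
      hθ hdec
  -- contradiction with the choice of `j`
  have hLpos : 0 < Real.log (ν j)⁻¹ := hL₀pos.trans hlog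
  rw [le_div_iff₀ hLpos] at hD
  have h1 : γ / 2 * L₀ < γ / 2 * Real.log (ν j)⁻¹ := mul_lt_mul_of_pos_left hlog (by positivity)
  have h2 : γ / 2 * L₀ = K + γ / 2 := by rw [hL₀]; field_simp
  linarith

/-! ## Corollary: uniformly bounded enstrophy from some phase on (ideator 1's target T2) -/

/-- **Uniformly bounded enstrophy from some phase on**: one `Z` such that every level `j` has a phase
`s_j ≥ 0` after which the drift `v_j(s_j + ·)` has essentially bounded energy and `‖∇v_j(s_j + t)‖²_{L²}
= eGradNormSq (v_j (s_j + t)) ≤ Z` for a.e. `t > 0` (the class of crux-ideate ideator 1's `UniformEnstrophy`,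
with the energy bound recorded). Single-shell forcing, uniformly band-limited stirring, laminar and
condensate regimes and `H¹`-convergent families all land here. -/
def BoundedEnstrophy (_g : 𝕋² → E²) (_h : 𝕋² → ℝ) (_ν : ℕ → ℝ) (v : ℕ → ℝ → 𝕋² → E²) : Prop :=
  ∃ Z : ℝ, ∀ j : ℕ, ∃ s : ℝ, 0 ≤ s ∧
    (∃ M' : ℝ≥0, ∀ᵐ t ∂(volume.restrict (Ioi (0 : ℝ))), ∫⁻ x, ‖v j (s + t) x‖ₑ ^ 2 ≤ M') ∧
    ∀ᵐ t ∂(volume.restrict (Ioi (0 : ℝ))), eGradNormSq (v j (s + t)) ≤ ENNReal.ofReal Z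

/-- `(ofReal Z)^{1/2} = ofReal (√Z)` in `ℝ≥0∞` (both sides vanish for `Z < 0`). [folklore] -/
theorem ofReal_rpow_half_eq_ofReal_sqrt (Z : ℝ) :
    ENNReal.ofReal Z ^ (1 / 2 : ℝ) = ENNReal.ofReal (Real.sqrt Z) := by
  rcases le_or_gt 0 Z with hZ | hZ
  · rw [ENNReal.ofReal_rpow_of_nonneg hZ (by norm_num), Real.sqrt_eq_rpow]
  · rw [ENNReal.ofReal_of_nonpos hZ.le, Real.sqrt_eq_zero'.2 hZ.le, ENNReal.ofReal_zero,
      ENNReal.zero_rpow_of_pos (by norm_num)]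

/-- A pointwise enstrophy bound `Z` from phase `s_j` on is a linear windowed budget with slope `√Z`. [folklore] -/
theorem linearEnstrophyBudget_of_boundedEnstrophy {g : 𝕋² → E²} {h : 𝕋² → ℝ} {ν : ℕ → ℝ}
    {v : ℕ → ℝ → 𝕋² → E²} (hB : BoundedEnstrophy g h ν v) : LinearEnstrophyBudget g h ν v := by
  obtain ⟨Z, hZ⟩ := hB
  refine ⟨Real.sqrt Z, Real.sqrt_nonneg Z, fun j => ?_⟩
  obtain ⟨s, hs, hE, hgrad⟩ := hZ j
  refine ⟨s, hs, hE, fun t ht => ?_⟩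
  have hgrad' : ∀ᵐ τ ∂(volume.restrict (Ioo (0 : ℝ) t)),
      eGradNormSq (v j (s + τ)) ^ (1 / 2 : ℝ) ≤ ENNReal.ofReal (Real.sqrt Z) := by
    have h1 := ae_restrict_of_ae_restrict_of_subset (Ioo_subset_Ioi_self : Ioo (0 : ℝ) t ⊆ Ioi 0) hgrad
    filter_upwards [h1] with τ hτ
    rw [← ofReal_rpow_half_eq_ofReal_sqrt]
    exact ENNReal.rpow_le_rpow hτ (by norm_num)
  calc ∫⁻ τ in Ioo 0 t, eGradNormSq (v j (s + τ)) ^ (1 / 2 : ℝ)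
        ≤ ∫⁻ _ in Ioo 0 t, ENNReal.ofReal (Real.sqrt Z) := lintegral_mono_ae hgrad'
    _ = ENNReal.ofReal (Real.sqrt Z * t) := by
        rw [lintegral_const, Measure.restrict_apply_univ, Real.volume_Ioo, sub_zero,
          ENNReal.ofReal_mul (Real.sqrt_nonneg Z)]
    _ ≤ ENNReal.ofReal (Real.sqrt Z * (1 + t)) := by
        refine ENNReal.ofReal_le_ofReal ?_
        have := Real.sqrt_nonneg Z
        nlinarith

/-- **`RelaxingFamily` is false without unbounded enstrophy** (T2 of `Cruxes/RelaxingFamily/SketchIdeator1.lean`,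
unconditional): no witness of the crux has `j`-uniformly bounded enstrophy from some phase on.
[cite: Seis2022, Thm 2 (arXiv:2003.08794 pp. 3–4)] -/
theorem relaxingFamily_false_without_unboundedEnstrophy : ¬ RelaxingFamilyUnder BoundedEnstrophy :=
  fun hB => relaxingFamily_false_without_superlinearEnstrophy
    (hB.mono fun _ _ _ _ => linearEnstrophyBudget_of_boundedEnstrophy)

/-! ## Corollary: quadratic windowed enstrophy budget (time-averaged enstrophy bounds) -/

/-- **Quadratic windowed enstrophy budget from some phase on**: one `Z ≥ 0` such that every level `j`
has a phase `s_j ≥ 0` after which the drift `v_j(s_j + ·)` has essentially bounded energy and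
`∫₀ᵗ ‖∇v_j(s_j + τ)‖²_{L²} dτ ≤ Z (1 + t)` for all `t > 0` — the receptacle of TIME-AVERAGED enstrophy
bounds (energy-balance estimates, the single-shell ShellPincer bound on `longTimeAvgSup` of the
enstrophy, Galerkin and condensate regimes). -/
def QuadraticEnstrophyBudget (_g : 𝕋² → E²) (_h : 𝕋² → ℝ) (_ν : ℕ → ℝ)
    (v : ℕ → ℝ → 𝕋² → E²) : Prop :=
  ∃ Z : ℝ, 0 ≤ Z ∧ ∀ j : ℕ, ∃ s : ℝ, 0 ≤ s ∧
    (∃ M' : ℝ≥0, ∀ᵐ t ∂(volume.restrict (Ioi (0 : ℝ))), ∫⁻ x, ‖v j (s + t) x‖ₑ ^ 2 ≤ M') ∧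
    ∀ t : ℝ, 0 < t → ∫⁻ τ in Ioo 0 t, eGradNormSq (v j (s + τ)) ≤ ENNReal.ofReal (Z * (1 + t))

/-- Cauchy–Schwarz on a window: `∫₀ᵗ f^{1/2} ≤ (∫₀ᵗ f)^{1/2} · t^{1/2}` for a.e.-measurable `f`. [folklore] -/
theorem setLIntegral_rpow_half_le {f : ℝ → ℝ≥0∞} {t : ℝ}
    (hf : AEMeasurable f (volume.restrict (Ioo 0 t))) :
    ∫⁻ τ in Ioo 0 t, f τ ^ (1 / 2 : ℝ) ≤
      (∫⁻ τ in Ioo 0 t, f τ) ^ (1 / 2 : ℝ) * ENNReal.ofReal t ^ (1 / 2 : ℝ) := by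
  have h := ENNReal.lintegral_mul_le_Lp_mul_Lq (volume.restrict (Ioo 0 t))
    Real.HolderConjugate.two_two (hf.pow_const (1 / 2 : ℝ)) (g := fun _ => 1) aemeasurable_const
  have e2 : ∀ x : ℝ≥0∞, (x ^ (1 / 2 : ℝ)) ^ (2 : ℝ) = x := fun x => by
    rw [← ENNReal.rpow_mul]; norm_num
  have e3 : (fun τ => f τ ^ (1 / 2 : ℝ)) * (fun _ => (1 : ℝ≥0∞)) = fun τ => f τ ^ (1 / 2 : ℝ) := by
    funext τ; simp
  rw [e3] at h
  simp only [e2, ENNReal.one_rpow, lintegral_const, Measure.restrict_apply_univ, Real.volume_Ioo,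
    sub_zero, one_mul] at h
  simpa only [one_div] using h

/-- **`RelaxingFamily` is false without super-linear growth of the windowed MEAN enstrophy**
(unconditional): no witness of the crux has, from some phase on, `∫₀ᵗ ‖∇v_j(s_j+τ)‖² dτ ≤ Z(1+t)` with one
`Z` — by Cauchy–Schwarz on each window this is a linear budget of `‖∇v_j‖_{L²}` with slope `√Z`
(measurability of the slice enstrophy from the Leray–Hopf class). [cite: Seis2022, Remark 1 (arXiv:2003.08794 p. 4)] -/
theorem relaxingFamily_false_without_superlinearMeanEnstrophy :
    ¬ RelaxingFamilyUnder QuadraticEnstrophyBudget := by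
  rintro ⟨g, h, hg, hgd, hgm, hh, hhm, hh0, ν, v₀, v, hν, hνlim, hLH, hbd, hE, ⟨Z, hZ, hq⟩, hrest⟩
  refine relaxingFamily_false_without_superlinearEnstrophy
    ⟨g, h, hg, hgd, hgm, hh, hhm, hh0, ν, v₀, v, hν, hνlim, hLH, hbd, hE,
      ⟨Real.sqrt Z, Real.sqrt_nonneg Z, fun j => ?_⟩, hrest⟩
  obtain ⟨s, hs, hEn, hbud⟩ := hq j
  refine ⟨s, hs, hEn, fun t ht => ?_⟩
  -- measurability of the slice enstrophy of the shifted drift on `(0,t)`, from the Leray–Hopf class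
  have hm : AEStronglyMeasurable (uncurry fun τ => v j (s + τ))
      (((volume : Measure ℝ).restrict (Ioo 0 t)).prod volume) := by
    have h1 := aestronglyMeasurable_stLift_translate hs le_rfl ((hLH j) (t + s) (by linarith)).weak.1
    have e : (fun τ => v j (τ + s)) = fun τ => v j (s + τ) := by funext τ; rw [add_comm]
    rw [e] at h1
    have h2 := Literature.Analysis.FunctionSpaces.Torus.aestronglyMeasurable_uncurry_of_stLift_restrict h1
    rwa [volume_restrict_prod_eq] at h2
  have hf : AEMeasurable (fun τ => eGradNormSq (v j (s + τ))) (volume.restrict (Ioo 0 t)) :=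
    aemeasurable_eGradNormSq_slice hm
  calc ∫⁻ τ in Ioo 0 t, eGradNormSq (v j (s + τ)) ^ (1 / 2 : ℝ)
      ≤ (∫⁻ τ in Ioo 0 t, eGradNormSq (v j (s + τ))) ^ (1 / 2 : ℝ) * ENNReal.ofReal t ^ (1 / 2 : ℝ) :=
        setLIntegral_rpow_half_le hf
    _ ≤ ENNReal.ofReal (Z * (1 + t)) ^ (1 / 2 : ℝ) * ENNReal.ofReal t ^ (1 / 2 : ℝ) := by
        gcongr
        exact hbud t ht
    _ = ENNReal.ofReal (Real.sqrt (Z * (1 + t)) * Real.sqrt t) := by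
        rw [ofReal_rpow_half_eq_ofReal_sqrt, ofReal_rpow_half_eq_ofReal_sqrt,
          ENNReal.ofReal_mul (Real.sqrt_nonneg _)]
    _ ≤ ENNReal.ofReal (Real.sqrt Z * (1 + t)) := by
        refine ENNReal.ofReal_le_ofReal ?_
        rw [Real.sqrt_mul hZ]
        have h1 : Real.sqrt t ≤ Real.sqrt (1 + t) := Real.sqrt_le_sqrt (by linarith)
        have h2 : Real.sqrt (1 + t) * Real.sqrt (1 + t) = 1 + t := Real.mul_self_sqrt (by linarith)
        have h3 := Real.sqrt_nonneg Z
        have h4 := Real.sqrt_nonneg (1 + t)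
        calc Real.sqrt Z * Real.sqrt (1 + t) * Real.sqrt t
            ≤ Real.sqrt Z * Real.sqrt (1 + t) * Real.sqrt (1 + t) := by gcongr
          _ = Real.sqrt Z * (1 + t) := by rw [mul_assoc, h2]

end Summit.AnomalousDissipation.AnomalousDissipation.Theorems.RelaxingFamily.Negative

end
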